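import Summits.Schanuel.Schanuel.Theorems.RootDecomp1KNW96Core10

/-!
# RootDecomp1KNW96Core — lens 6, generation 24 «NW96 THEOREM 5(1) AS PRINTED (105500), HYPOTHESIS-FREE» (RULE G25 (iii); CLAIM L2202/L2203, CHECKLIST G25-α = ACK L2204, NODE L2222 / REQUEST L2223, writer re-check L2227, critic VERDICT L2233: CLEARED — THEOREM ×1 «`theorem …RootDecomp1KNW96Core.nesterenkoWaldschmidt1996_thm_5_1_holds : Literature.NumberTheory.Transcendental.NesterenkoWaldschmidt1996_thm_5_1` by proof»; the AUDIT-G22 gap «thm_5_1 registered, unproved» CLOSED; RULE G26; lens-6 tally THEOREM ×8 + CELL ×3 + AUDIT ×1) — continuation (RootDecomp1KNW96Core11): §2 the four named cells `cell_IA`, `cell_IB`, `regimeII_eb`, `cell_IIA`, `cell_IIB`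

(lens-6 g24 HOME kernel K = HOME/decomp-schanuel-lens-6/g24/NW96Thm51.lean b14a307c…, 880 l, imports tree `…RootDecomp1KNW96Core07` + Literature `…ExpAlgebraicApproximationMeasure`; P NW96Thm51Probe.lean 86491eb5… rc 0; C NW96Thm51Controls.lean 2460ef9c… rc 1 = exactly the 9 planted errors. Port by census-1 gen 19 as `RootDecomp1KNW96Core10`–`12` (the verdict's «Core10, one file, 880 l» split for the 400-line cap): 10 = §1–§2 numerics (`exp`/`log` pins, `log(t+2) ≤ log t + 2/t`, `x ≤ e^{x−1}`, `e·x ≤ e^x`, `x²e^{2−x} ≤ e·x`, `e²x ≤ 2e^x`, `W ≤ 19.4366`), the link cell core `cellB_core` per `D ∈ {1,2,3,4}, ≥ 5` and `F3_le_regimeI`; 11 = the FOUR NAMED CELLS `cell_IA` (120), `cell_IB` (252 ≤ 263.75), `regimeII_eb`, `cell_IIA` (1046.052 ≤ 1055, binding), `cell_IIB` (link cell); 12 = `thm51_budget`, the ONE comparison theorem `thm51_exponent_le` (constant 1055/4 · c) + `_400`, `norm_le_thm51_exponent`, §3 the c-generic slot `NW1996Thm51C`, `nw1996Thm51C_iff`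 (Iff.rfl), (a) `weilHeight₁_unit_eq_vec`, (b) the LINK `neg_height_le_log_norm`, (c) `exp_neg_le_norm_exp_sub_zero`, the instance `thm51C_of_mainR (hc : 1 ≤ c) (hNW : NW1996MainR c) : NW1996Thm51C (1055/4 * c)` (θ := β, A′ := A, B′ := e^{h(β)}, E′ := max(E, e²)), `nw1996Thm51C_105500` and the headline `nesterenkoWaldschmidt1996_thm_5_1_holds` HYPOTHESIS-FREE.
PORT EDITS: the file-wide `set_option linter.dupNamespace false` dropped; the thirteen generic `exp`/`log` numerics lemmas of §1 made `private` (dedup-safety: Literature twins) and K's `log_add_two_le` (log(t+2) ≤ log t + 2/t) RENAMED `log_add_two_le_two_div` — the gate's fqn lint refuses the short name, already taken by Core08's `log_add_two_le` (log(n+2) ≤ log n + 1.1) in the same namespace with per-part private copies where a later part uses them; the slot def's docstring tagged «[slot] c-generic statement def …» (census convention, verdict condition); statements and proofs otherwise verbatim. `--supports stmt-Schanuel-33364`; no census credit carried; rung 0 — nothing here proves Schanuel. CONSEQUENCE OF RECORD (G25 (i) pattern, RULE G26 (i)): every `(hNW : NesterenkoWaldschmidt1996_thm_5_1)` binder in the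 tree (Hyper19, FiniteOrderCell04, StoreyOneAtlas02, PowerLineOrder02 …) is dischargeable BY NAME — census relabel bookkeeping ×0; the Literature `_holds` companion waits for the relocation of the NW96Core chain into Literature (Literature must not import Summits).)
-/

noncomputable section

namespace Summit.Schanuel.Schanuel.Theorems.RootDecomp1KNW96Core

open Literature.NumberTheory.Transcendental

section Thm51Numerics

open Real

/-- `2.7182818283 < e < 2.7182818286`. [folklore] -/
private theorem exp_one_bounds : (2.7182818283 : ℝ) < exp 1 ∧ exp 1 < 2.7182818286 :=
  ⟨Real.exp_one_gt_d9, Real.exp_one_lt_d9⟩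

/-- `7.389 < e²`. [folklore] -/
private theorem exp_two_gt : (7.389 : ℝ) < exp 2 := by
  have h := Real.exp_one_gt_d9
  have e : exp 2 = exp 1 * exp 1 := by rw [← Real.exp_add]; norm_num
  rw [e]; nlinarith

/-- `x ≤ e^{x−1}`. [folklore] -/
private theorem le_exp_sub_one (x : ℝ) : x ≤ exp (x - 1) := by
  have := Real.add_one_le_exp (x - 1); linarith

/-- `e·x ≤ e^x`. [folklore] -/
private theorem exp_one_mul_le_exp (x : ℝ) : exp 1 * x ≤ exp x := by
  have h := le_exp_sub_one x
  have e : exp x = exp 1 * exp (x - 1) := by rw [← Real.exp_add]; ring_nf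
  rw [e]; exact mul_le_mul_of_nonneg_left h (exp_pos 1).le

/-- `x²·e^{2−x} ≤ e·x` for `x ≥ 0`. [folklore] -/
private theorem sq_mul_exp_two_sub_le {x : ℝ} (hx : 0 ≤ x) : x ^ 2 * exp (2 - x) ≤ exp 1 * x := by
  have h := exp_one_mul_le_exp x
  have e : exp 1 * x = (exp 1 * x) * (exp (2 - x) * exp (x - 1)) / exp 1 := by
    rw [← Real.exp_add]; field_simp; ring_nf
  have e2 : x ^ 2 * exp (2 - x) = x * (exp (2 - x) * x) := by ring
  rw [e2]
  have : exp (2 - x) * x ≤ exp (2 - x) * exp (x - 1) :=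
    mul_le_mul_of_nonneg_left (le_exp_sub_one x) (exp_pos _).le
  calc x * (exp (2 - x) * x) ≤ x * (exp (2 - x) * exp (x - 1)) := mul_le_mul_of_nonneg_left this hx
    _ = exp 1 * x := by rw [← Real.exp_add]; ring_nf

/-- `e²·x ≤ 2·e^x` for `x ≥ 2` (`e^{x−2} ≥ x − 1 ≥ x/2`). [folklore] -/
private theorem exp_two_mul_le {x : ℝ} (hx : 2 ≤ x) : exp 2 * x ≤ 2 * exp x := by
  have h := Real.add_one_le_exp (x - 2)
  have e : exp x = exp 2 * exp (x - 2) := by rw [← Real.exp_add]; ring_nf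
  rw [e]; nlinarith [exp_pos (2 : ℝ), exp_pos (x - 2)]

/-- `W = x + 2e + 12 ≤ 19.4366` on `x ≤ 2`. [folklore] -/
private theorem W_le {x : ℝ} (hx2 : x ≤ 2) : x + 2 * exp 1 + 12 ≤ 19.4366 := by
  linarith [exp_one_bounds.2]

/-! #### The four cells (atoms: `D` degree, `S = D·L`, `x = log E`, `σ = log S`, `u = log D`,
`ℓ = log₊ L`, `lb = log₊ b`, `h = h(β)`, `b = |β|`, `F₃ = 3.3·D·log(D+2)`) -/

/-- **Cell I-A** (`x ≥ 2`, `σ ≥ x`): `F₁ ≤ 6 T₁`, `F₂ ≤ 5 S`, `F₃ + x ≤ 4 T₃`; product constant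
`6·5·4 = 120 ≤ 1055/4`. [folklore] -/
theorem cell_IA {D S x σ u ℓ lb h b F₃ : ℝ} (hx2 : 2 ≤ x) (hσx : x ≤ σ) (hS0 : 0 < S)
    (hSexp : exp σ = S) (hb : 0 < b) (hbE : b * exp x ≤ S) (hh : 0 ≤ h) (hℓ0 : 0 ≤ ℓ)
    (hℓL : σ - u ≤ ℓ) (hlb1 : lb ≤ σ - x) (hDu0 : 0 ≤ D * u) (hF3_0 : 0 ≤ F₃)
    (hF3 : F₃ + x ≤ 4 * (D * u + x)) :
    (h + (σ - u) + 4 * u + 2 * (x + lb) + 10) * (S + 2 * exp x * b + 6 * x) * (F₃ + x) * x ^ 2 ≤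
      1055 / 4 * S * (h + ℓ + u + x) * (D * u + x) * x ^ 2 := by
  have hx0 : 0 ≤ x := by linarith
  have hT1_0 : 0 ≤ h + ℓ + u + x := by linarith
  have hT3_0 : 0 ≤ D * u + x := by linarith
  have hST : 0 ≤ S * (h + ℓ + u + x) * (D * u + x) := mul_nonneg (mul_nonneg hS0.le hT1_0) hT3_0
  have hF30 : 0 ≤ F₃ + x := by linarith
  have h2eb : 0 ≤ 2 * exp x * b := by positivity
  have hF2_0 : 0 ≤ S + 2 * exp x * b + 6 * x := by linarith
  have hexb : 2 * exp x * b ≤ 2 * S := by linarith [hbE]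
  have hF1 : h + (σ - u) + 4 * u + 2 * (x + lb) + 10 ≤ 6 * (h + ℓ + u + x) := by linarith
  have hexS : exp x ≤ S := by rw [← hSexp]; exact Real.exp_le_exp.mpr hσx
  have h6x : 6 * x ≤ 2 * S := by
    have h1 := exp_two_mul_le hx2
    have h2 : 7.389 * x ≤ exp 2 * x := mul_le_mul_of_nonneg_right exp_two_gt.le hx0
    linarith
  have hF2 : S + 2 * exp x * b + 6 * x ≤ 5 * S := by linarith
  have p1 := mul_le_mul hF1 hF2 hF2_0 (by linarith)
  have p2 := mul_le_mul p1 hF3 hF30 (mul_nonneg (by linarith) (by linarith))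
  have p3 := mul_le_mul_of_nonneg_right p2 (sq_nonneg x)
  have hnn := mul_nonneg hST (sq_nonneg x)
  linarith [p3, hnn]

/-- **Cell I-B** (`x ≥ 2`, `σ < x`, so `log₊ b = 0`): `F₁ ≤ 7 T₁`, `F₂ ≤ 9 S`, `F₃ + x ≤ 4 T₃`; product
constant `7·9·4 = 252 ≤ 1055/4`. [folklore] -/
theorem cell_IB {D S x σ u ℓ lb h b F₃ : ℝ} (hx2 : 2 ≤ x) (hxS : x ≤ S) (hS0 : 0 < S)
    (hb : 0 < b) (hbE : b * exp x ≤ S) (hh : 0 ≤ h) (hu0 : 0 ≤ u) (hℓ0 : 0 ≤ ℓ)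
    (hℓL : σ - u ≤ ℓ) (hlb1 : lb = 0) (hDu0 : 0 ≤ D * u) (hF3_0 : 0 ≤ F₃)
    (hF3 : F₃ + x ≤ 4 * (D * u + x)) :
    (h + (σ - u) + 4 * u + 2 * (x + lb) + 10) * (S + 2 * exp x * b + 6 * x) * (F₃ + x) * x ^ 2 ≤
      1055 / 4 * S * (h + ℓ + u + x) * (D * u + x) * x ^ 2 := by
  have hx0 : 0 ≤ x := by linarith
  have hT1_0 : 0 ≤ h + ℓ + u + x := by linarith
  have hT3_0 : 0 ≤ D * u + x := by linarith
  have hST : 0 ≤ S * (h + ℓ + u + x) * (D * u + x) := mul_nonneg (mul_nonneg hS0.le hT1_0) hT3_0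
  have hF30 : 0 ≤ F₃ + x := by linarith
  have h2eb : 0 ≤ 2 * exp x * b := by positivity
  have hF2_0 : 0 ≤ S + 2 * exp x * b + 6 * x := by linarith
  have hexb : 2 * exp x * b ≤ 2 * S := by linarith [hbE]
  have hF1 : h + (σ - u) + 4 * u + 2 * (x + lb) + 10 ≤ 7 * (h + ℓ + u + x) := by linarith
  have hF2 : S + 2 * exp x * b + 6 * x ≤ 9 * S := by linarith
  have p1 := mul_le_mul hF1 hF2 hF2_0 (by linarith)
  have p2 := mul_le_mul p1 hF3 hF30 (mul_nonneg (by linarith) (by linarith))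
  have p3 := mul_le_mul_of_nonneg_right p2 (sq_nonneg x)
  have hnn := mul_nonneg hST (sq_nonneg x)
  linarith [p3, hnn]

/-- In Regime II (`1 ≤ x ≤ 2`, `y = 2`): `2 e² b x² ≤ 2 e S x` (from `b ≤ S e^{−x}` and `x² e^{2−x} ≤ e x`).
[folklore] -/
theorem regimeII_eb {S x b : ℝ} (hx0 : 0 ≤ x) (hS0 : 0 < S) (hbS : b ≤ S / exp x) :
    2 * exp 2 * b * x ^ 2 ≤ 2 * exp 1 * S * x := by
  have h1 : exp 2 * b ≤ S * exp (2 - x) := by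
    calc exp 2 * b ≤ exp 2 * (S / exp x) := mul_le_mul_of_nonneg_left hbS (exp_pos 2).le
      _ = S * exp (2 - x) := by rw [Real.exp_sub]; ring
  have h2 := mul_le_mul_of_nonneg_left (sq_mul_exp_two_sub_le hx0) (show 0 ≤ 2 * S by linarith)
  have h3 := mul_le_mul_of_nonneg_left h1 (show 0 ≤ 2 * x ^ 2 by positivity)
  have e1 : 2 * x ^ 2 * (S * exp (2 - x)) = 2 * S * (x ^ 2 * exp (2 - x)) := by ring
  have e2 : 2 * exp 2 * b * x ^ 2 = 2 * x ^ 2 * (exp 2 * b) := by ring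
  have e3 : 2 * exp 1 * S * x = 2 * S * (exp 1 * x) := by ring
  rw [e2, e3]; rw [e1] at h3
  exact h3.trans h2

/-- **Cell II-A** (`1 ≤ x ≤ 2`, `σ ≥ x`): `F₁ ≤ 9 T₁`, `F₂ x² ≤ 11.86 S x`, `x (F₃ + 2) ≤ 9.8 T₃`;
product constant `9 · 11.86 · 9.8 = 1046.052 ≤ 1055 = 4 · (1055/4)`. [folklore] -/
theorem cell_IIA {D S x σ u ℓ lb h b F₃ : ℝ} (hx : 1 ≤ x) (hx2 : x ≤ 2) (hσx : x ≤ σ) (hS0 : 0 < S)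
    (hSexp : exp σ = S) (hb : 0 < b) (hbS : b ≤ S / exp x) (hh : 0 ≤ h) (hu0 : 0 ≤ u) (hℓ0 : 0 ≤ ℓ)
    (hℓL : σ - u ≤ ℓ) (hlb1 : lb ≤ σ - x) (hDu0 : 0 ≤ D * u) (hF3_0 : 0 ≤ F₃)
    (hF3c : F₃ ≤ 33 / 10 * D * u + 33 / 5) :
    (h + (σ - u) + 4 * u + 2 * (2 + lb) + 10) * (S + 2 * exp 2 * b + 6 * 2) * (F₃ + 2) * x ^ 2 ≤
      1055 / 4 * S * (h + ℓ + u + x) * (D * u + x) * (2 : ℝ) ^ 2 := by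
  have hx0 : 0 ≤ x := by linarith
  have hT1_0 : 0 ≤ h + ℓ + u + x := by linarith
  have hT3_0 : 0 ≤ D * u + x := by linarith
  obtain ⟨he1, he2⟩ := exp_one_bounds
  have hSx0 : 0 ≤ S * x := mul_nonneg hS0.le hx0
  have he2b := regimeII_eb hx0 hS0 hbS
  have hF3' : F₃ + 2 ≤ 33 / 10 * (D * u) + 43 / 5 := by linarith
  have hF30 : 0 ≤ F₃ + 2 := by linarith
  have h2eb : 0 ≤ 2 * exp 2 * b := by positivity
  have hF2_0 : 0 ≤ S + 2 * exp 2 * b + 6 * 2 := by linarith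
  have hM0 : 0 ≤ (S + 2 * exp 2 * b + 6 * 2) * x ^ 2 := mul_nonneg hF2_0 (sq_nonneg x)
  have hF1 : h + (σ - u) + 4 * u + 2 * (2 + lb) + 10 ≤ 9 * (h + ℓ + u + x) := by linarith
  have hexS : exp x ≤ S := by rw [← hSexp]; exact Real.exp_le_exp.mpr hσx
  have heS : exp 1 * x ≤ S := (exp_one_mul_le_exp x).trans hexS
  have h12 : 12 * x ^ 2 ≤ 4.4146 * (S * x) := by
    have h1 : 2.7182818283 * x ≤ exp 1 * x := mul_le_mul_of_nonneg_right he1.le hx0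
    have h2 : 2.7182818283 * x * x ≤ S * x := mul_le_mul_of_nonneg_right (h1.trans heS) hx0
    have e : (12 : ℝ) * x ^ 2 = 12 / 2.7182818283 * (2.7182818283 * x * x) := by ring
    rw [e]
    linarith [h2]
  have hSxx : S * x * x ≤ S * x * 2 := mul_le_mul_of_nonneg_left hx2 hSx0
  have heSx : exp 1 * (S * x) ≤ 2.7182818286 * (S * x) := mul_le_mul_of_nonneg_right he2.le hSx0
  have hF2 : (S + 2 * exp 2 * b + 6 * 2) * x ^ 2 ≤ 11.86 * (S * x) := by
    have e : (S + 2 * exp 2 * b + 6 * 2) * x ^ 2 = S * x * x + 2 * exp 2 * b * x ^ 2 + 12 * x ^ 2 := by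
      ring
    have e' : 2 * exp 1 * S * x = 2 * (exp 1 * (S * x)) := by ring
    rw [e]; rw [e'] at he2b
    linarith [he2b, h12, hSxx, heSx]
  have hF3x : x * (F₃ + 2) ≤ 98 / 10 * (D * u + x) := by
    have p_a := mul_le_mul_of_nonneg_left hF3' hx0
    have p_b : D * u * x ≤ D * u * 2 := mul_le_mul_of_nonneg_left hx2 hDu0
    have e : x * (33 / 10 * (D * u) + 43 / 5) = 33 / 10 * (D * u * x) + 43 / 5 * x := by ring
    rw [e] at p_a
    linarith [p_a, p_b]
  -- assemble
  have p1 := mul_le_mul hF1 hF2 hM0 (by linarith)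
  have p2 := mul_le_mul_of_nonneg_right p1 hF30
  have hST1 : 0 ≤ S * (h + ℓ + u + x) := mul_nonneg hS0.le hT1_0
  have p3 := mul_le_mul_of_nonneg_left hF3x (show 0 ≤ 9 * 11.86 * (S * (h + ℓ + u + x)) by positivity)
  have e1 : (h + (σ - u) + 4 * u + 2 * (2 + lb) + 10) * (S + 2 * exp 2 * b + 6 * 2) * (F₃ + 2) * x ^ 2 =
      (h + (σ - u) + 4 * u + 2 * (2 + lb) + 10) * ((S + 2 * exp 2 * b + 6 * 2) * x ^ 2) * (F₃ + 2) := by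
    ring
  have e2 : 9 * (h + ℓ + u + x) * (11.86 * (S * x)) * (F₃ + 2) =
      9 * 11.86 * (S * (h + ℓ + u + x)) * (x * (F₃ + 2)) := by ring
  have e3 : 1055 / 4 * S * (h + ℓ + u + x) * (D * u + x) * (2 : ℝ) ^ 2 =
      1055 * (S * (h + ℓ + u + x)) * (D * u + x) := by ring
  rw [e1, e3]
  refine p2.trans ?_
  rw [e2]
  have hST3 := mul_nonneg hST1 hT3_0
  have e4 : 1055 * (S * (h + ℓ + u + x)) * (D * u + x) = 1055 * (S * (h + ℓ + u + x) * (D * u + x)) := by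
    ring
  have e5 : 9 * 11.86 * (S * (h + ℓ + u + x)) * (98 / 10 * (D * u + x)) =
      9 * 11.86 * (98 / 10) * (S * (h + ℓ + u + x) * (D * u + x)) := by ring
  rw [e5] at p3; rw [e4]
  linarith [p3, hST3]

/-- **Cell II-B** (`1 ≤ x ≤ 2`, `σ < x`, the LINK cell: `log₊ b = 0`, `D·h ≥ x − σ`).  With
`A := F₂ x² (F₃ + 2)`, `N := 1055 · S · T₃`: the slope `A ≤ N` (`x·W ≤ 38.88`, `F₃ + 2 ≤ 8.6 T₃`:
`334.3 ≤ 1055`) and the degree inequality `cellB_core` (`D·P·A ≤ Q_D·N`) give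
`(h + p)·A ≤ (h + Λ)·N` for all `h ≥ (x − σ)/D`. [folklore] -/
theorem cell_IIB {D S x σ u ℓ lb h b F₃ : ℝ} (hD1 : 1 ≤ D) (hx : 1 ≤ x) (hx2 : x ≤ 2) (hσx : σ < x)
    (hxS : x ≤ S) (hS0 : 0 < S) (hb : 0 < b) (hbS : b ≤ S / exp x) (hu0 : 0 ≤ u)
    (hℓ0 : 0 ≤ ℓ) (hℓL : σ - u ≤ ℓ) (hlb1 : lb = 0) (hlinkσ : x - σ ≤ D * h) (hDu0 : 0 ≤ D * u)
    (hF3_0 : 0 ≤ F₃) (hF3c : F₃ ≤ 33 / 10 * D * u + 33 / 5)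
    (hcore : D * ((x + 3 * u + 14) * (x * (x + 2 * exp 1 + 12) * (F₃ + 2))) ≤
      1055 * (x - u + D * (u + x)) * (D * u + x)) :
    (h + (σ - u) + 4 * u + 2 * (2 + lb) + 10) * (S + 2 * exp 2 * b + 6 * 2) * (F₃ + 2) * x ^ 2 ≤
      1055 / 4 * S * (h + ℓ + u + x) * (D * u + x) * (2 : ℝ) ^ 2 := by
  have hx0 : 0 ≤ x := by linarith
  have hD0 : 0 < D := by linarith
  have hT3_0 : 0 ≤ D * u + x := by linarith
  have hW := W_le hx2
  have hW0 : 0 ≤ x + 2 * exp 1 + 12 := by linarith [exp_one_bounds.1]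
  have he2b := regimeII_eb hx0 hS0 hbS
  have hF3' : F₃ + 2 ≤ 33 / 10 * (D * u) + 43 / 5 := by linarith
  have hF30 : 0 ≤ F₃ + 2 := by linarith
  have h2eb : 0 ≤ 2 * exp 2 * b := by positivity
  have hF2_0 : 0 ≤ S + 2 * exp 2 * b + 6 * 2 := by linarith
  have hM0 : 0 ≤ (S + 2 * exp 2 * b + 6 * 2) * x ^ 2 := mul_nonneg hF2_0 (sq_nonneg x)
  have hDℓ : σ - u ≤ D * ℓ := by
    have := mul_nonneg (sub_nonneg.2 hD1) hℓ0
    linarith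
  -- A ≤ S · xW · (F₃ + 2)
  have hF2W : (S + 2 * exp 2 * b + 6 * 2) * x ^ 2 ≤ S * (x * (x + 2 * exp 1 + 12)) := by
    have h12 : x * x ≤ S * x := mul_le_mul_of_nonneg_right hxS hx0
    have e : (S + 2 * exp 2 * b + 6 * 2) * x ^ 2 = S * (x * x) + 2 * exp 2 * b * x ^ 2 + 12 * (x * x) := by
      ring
    have e' : S * (x * (x + 2 * exp 1 + 12)) = S * (x * x) + 2 * exp 1 * S * x + 12 * (S * x) := by ring
    rw [e, e']
    linarith [he2b, h12]
  have hA0 : 0 ≤ (S + 2 * exp 2 * b + 6 * 2) * x ^ 2 * (F₃ + 2) := mul_nonneg hM0 hF30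
  have hN0 : 0 ≤ 1055 * S * (D * u + x) := by positivity
  have hxW : x * (x + 2 * exp 1 + 12) ≤ 2 * 19.4366 := mul_le_mul hx2 hW hW0 (by norm_num)
  have hxW0 : 0 ≤ x * (x + 2 * exp 1 + 12) := mul_nonneg hx0 hW0
  -- slope: A ≤ N
  have hMN : (S + 2 * exp 2 * b + 6 * 2) * x ^ 2 * (F₃ + 2) ≤ 1055 * S * (D * u + x) := by
    have h2 : F₃ + 2 ≤ 43 / 5 * (D * u + x) := by linarith
    have h3 := mul_le_mul hF2W h2 hF30 (mul_nonneg hS0.le hxW0)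
    have h4 : S * (x * (x + 2 * exp 1 + 12)) ≤ S * (2 * 19.4366) := mul_le_mul_of_nonneg_left hxW hS0.le
    have h5 := mul_le_mul_of_nonneg_right h4 (show 0 ≤ 43 / 5 * (D * u + x) by positivity)
    have hST3 := mul_nonneg hS0.le hT3_0
    have e : S * (2 * 19.4366) * (43 / 5 * (D * u + x)) = 2 * 19.4366 * (43 / 5) * (S * (D * u + x)) := by
      ring
    have e' : 1055 * S * (D * u + x) = 1055 * (S * (D * u + x)) := by ring
    rw [e] at h5; rw [e']
    linarith [h3, h5, hST3]
  -- the degree inequality, times S:  D·P·A ≤ Q_D·N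
  have hPM : D * (x + 3 * u + 14) * ((S + 2 * exp 2 * b + 6 * 2) * x ^ 2 * (F₃ + 2)) ≤
      (x - u + D * (u + x)) * (1055 * S * (D * u + x)) := by
    have h1 := mul_le_mul_of_nonneg_right hF2W hF30
    have hP0 : 0 ≤ D * (x + 3 * u + 14) := by positivity
    have h2 := mul_le_mul_of_nonneg_left h1 hP0
    have h3 := mul_le_mul_of_nonneg_left hcore hS0.le
    have e1 : D * (x + 3 * u + 14) * (S * (x * (x + 2 * exp 1 + 12)) * (F₃ + 2)) =
        S * (D * ((x + 3 * u + 14) * (x * (x + 2 * exp 1 + 12) * (F₃ + 2)))) := by ring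
    have e2 : S * (1055 * (x - u + D * (u + x)) * (D * u + x)) =
        (x - u + D * (u + x)) * (1055 * S * (D * u + x)) := by ring
    rw [e1] at h2; rw [e2] at h3
    exact h2.trans h3
  -- reshape the goal to `(h + p) · A ≤ (h + Λ) · N` and atomise `A`, `N`
  have e1 : (h + (σ - u) + 4 * u + 2 * (2 + lb) + 10) * (S + 2 * exp 2 * b + 6 * 2) * (F₃ + 2) * x ^ 2 =
      (h + (σ - u) + 4 * u + 2 * (2 + lb) + 10) * ((S + 2 * exp 2 * b + 6 * 2) * x ^ 2 * (F₃ + 2)) := by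
    ring
  have e2 : 1055 / 4 * S * (h + ℓ + u + x) * (D * u + x) * (2 : ℝ) ^ 2 =
      (h + ℓ + u + x) * (1055 * S * (D * u + x)) := by ring
  rw [e1, e2, hlb1]
  generalize hA : (S + 2 * exp 2 * b + 6 * 2) * x ^ 2 * (F₃ + 2) = A at hA0 hMN hPM ⊢
  generalize hN : 1055 * S * (D * u + x) = N at hN0 hMN hPM ⊢
  -- the three linear facts and the assembly `D·[(h+Λ)N − (h+p)A] ≥ 0`
  have t4 : x - u + D * (u + x) ≤ (x - σ) + D * (ℓ + u + x) := by
    have e : D * (ℓ + u + x) = D * ℓ + D * (u + x) := by ring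
    rw [e]; linarith [hDℓ]
  have t5 : (x - σ) + D * (σ + 3 * u + 14) ≤ D * (x + 3 * u + 14) := by
    have := mul_le_mul_of_nonneg_left hσx.le (sub_nonneg.2 hD1)
    have e : D * (σ + 3 * u + 14) = (D - 1) * σ + σ + D * (3 * u + 14) := by ring
    have e' : D * (x + 3 * u + 14) = (D - 1) * x + x + D * (3 * u + 14) := by ring
    rw [e, e']; linarith
  have i1 := mul_le_mul_of_nonneg_right hlinkσ (sub_nonneg.2 hMN)
  have i2 := mul_le_mul_of_nonneg_right t4 hN0
  have i3 := mul_le_mul_of_nonneg_right t5 hA0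
  have key : D * ((h + (σ - u) + 4 * u + 2 * (2 + 0) + 10) * A) ≤ D * ((h + ℓ + u + x) * N) := by
    have e : D * ((h + (σ - u) + 4 * u + 2 * (2 + 0) + 10) * A) =
        D * h * A + ((x - σ) + D * (σ + 3 * u + 14)) * A - (x - σ) * A := by ring
    have e' : D * ((h + ℓ + u + x) * N) = D * h * N + ((x - σ) + D * (ℓ + u + x)) * N - (x - σ) * N := by
      ring
    rw [e, e']
    have i1' : (x - σ) * N - (x - σ) * A ≤ D * h * N - D * h * A := by
      have e1 : (x - σ) * (N - A) = (x - σ) * N - (x - σ) * A := by ring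
      have e2 : D * h * (N - A) = D * h * N - D * h * A := by ring
      rw [← e1, ← e2]; exact i1
    linarith [i1', i2, i3, hPM]
  exact le_of_mul_le_mul_left key hD0

end Thm51Numerics

end Summit.Schanuel.Schanuel.Theorems.RootDecomp1KNW96Core

end
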